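import Summits.HodgeConjecture.HodgeConjecture.Theorems.F0P3cStCharTSRootCalculus          -- ★ (LH4-p03 g7) `exists_forall_root_near` (roots of nearby monic polynomials are near the old roots)
import Summits.HodgeConjecture.HodgeConjecture.Theorems.F0P3cStCharTSRootCount             -- ★ p851513 `exists_pos_le_of_finset`
import Summits.HodgeConjecture.HodgeConjecture.Theorems.F0P3cStCharTSEllOpen               -- ★ `continuous_evalPlace_charpoly_coeff`
import Literature.NumberTheory.Automorphic.AdicCompletionCompact                           -- ★ `properSpace_adicCompletion` (`L_w` is proper)
import HarnessLib

/-!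
# F0 · P3c · line LH6 «StCharTS» — «NORM-ONE-ROOTS-NEAR★» (brick (b′) of S13b «UPR-LC», road (I)): near a regular `x`, EVERY norm-one root of `(charpoly y)_w` is one of the moved
# norm-one roots `u_a(y)` — no new norm-one roots appear [Rogawski1990, §5.4 p. 78; §12.5 pp. 182–184]

Cell `pub/hodgecm-mathlib`, crux H413 = `stmt-HodgeConjecture-24833` (lane `--supports … --as helper`), route HCCMUnconditional; seat F0P3-p02 (g20); datum road of the (S-𝔇)
organ `stub_EllipticPackage`; slice S13b «UPR-LC» (PLAN `F0/P3/F0P3-p02/g20/S13b-PLAN.v1.F0P3p02g20.md`), brick (b′) = exhaustivity of the moved transversal.  Inputs: ★ ROOT-CALCULUS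
`exists_forall_root_near` (every root of a nearby monic cubic is near an old root), the window clauses of ★ MOVING-ROOT `exists_continuousAt_root` for the old norm-one roots (taken
VERBATIM as hypotheses, indexed by a finset `A ⊇ {norm-one roots of (charpoly x)_w}`), and openness of `{r : σ_w r · r ≠ 1}` around the old non-norm-one roots.
THEOREMS ONLY (no definition ∕ instance ∕ notation ∕ named fact ∕ `sorry`); ★-only imports.
HONEST LABEL: HC_CM is proved only modulo the 7 printed citations (2 remaining named inputs: hLiu418 = `stmt-HodgeConjecture-24832`, h413 = `stmt-HodgeConjecture-24833`)
until rung 0 closes; this file closes no organ, count-neutral.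

* `monic_map_charpoly`, `natDegree_map_charpoly` — `(charpoly y)_w` is monic of degree `3`;
* `eventually_forall_root_near` — for `y` near `x` every root of `(charpoly y)_w` is within `η` of a root of `(charpoly x)_w`;
* HEAD `eventually_forall_norm_one_root_eq` — for `y` near `x`, every norm-one root of `(charpoly y)_w` is `u_a(y)` for some `a ∈ A`.

## References
* [Rogawski1990] J. D. Rogawski, *Automorphic Representations of Unitary Groups in Three Variables*, Ann. of Math. Stud. 123 (1990): §5.4 p. 78 (the stable classes of `H` transferring
  to `γ`, read on the norm-one eigenvalues), §12.5 pp. 182–184.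
* [Gouvea1993PadicNumbers] F. Q. Gouvêa, *p-adic Numbers* (1993), §3.4 ∕ §6.8 — continuity of roots, background only.
-/

set_option autoImplicit false
-- the mandated namespace has the single-problem summit's repeated segment (`HodgeConjecture.HodgeConjecture`)
set_option linter.dupNamespace false

noncomputable section

open Polynomial Filter Topology
open NumberField IsDedekindDomain
open scoped Matrix MatrixGroups
open Literature.NumberTheory.Automorphic Literature.NumberTheory.Automorphic.UnitaryGroup
open Literature.NumberTheory.Rogawski1990

namespace Summit.HodgeConjecture.HodgeConjecture.Cruxes.H413.F0P3cStCharTSNormOneRootsNear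

variable (L : Type) [Field L] [NumberField L] [IsCMField L] (v : HeightOneSpectrum (𝓞 ↥(maximalRealSubfield L)))

/-- `(charpoly y)_w` is monic. -/
theorem monic_map_charpoly (w : PlacesOver L v) (y : Gqs L v) :
    (((y.val : GL (Fin 3) (UnitaryGroup.LocalRing L v)).val.charpoly).map (Pi.evalRingHom (fun w' : PlacesOver L v => w'.1.adicCompletion L) w)).Monic :=
  (Matrix.charpoly_monic _).map _

/-- `(charpoly y)_w` has degree `3`. -/
theorem natDegree_map_charpoly (w : PlacesOver L v) (y : Gqs L v) :
    (((y.val : GL (Fin 3) (UnitaryGroup.LocalRing L v)).val.charpoly).map (Pi.evalRingHom (fun w' : PlacesOver L v => w'.1.adicCompletion L) w)).natDegree = 3 := by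
  haveI : Nontrivial (UnitaryGroup.LocalRing L v) := ⟨⟨0, 1, fun h => zero_ne_one (congrFun h w)⟩⟩
  rw [(Matrix.charpoly_monic _).natDegree_map, Matrix.charpoly_natDegree_eq_dim, Fintype.card_fin]

/-- **Roots move little**: for every `η > 0`, for `y` near `x`, every root of `(charpoly y)_w` lies within `η` of a root of `(charpoly x)_w` (★ `exists_forall_root_near` fed with the
coefficient continuity ★ `continuous_evalPlace_charpoly_coeff` via ★ `eventually_forall_norm_coeff_sub_lt`). [cite: Rogawski1990, §12.5 p. 183] -/
theorem eventually_forall_root_near (w : PlacesOver L v) (x : Gqs L v) {η : ℝ} (hη : 0 < η) :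
    ∀ᶠ y in 𝓝 x, ∀ r : w.1.adicCompletion L,
      (((y.val : GL (Fin 3) (UnitaryGroup.LocalRing L v)).val.charpoly).map (Pi.evalRingHom (fun w' : PlacesOver L v => w'.1.adicCompletion L) w)).IsRoot r →
        ∃ a ∈ (((x.val : GL (Fin 3) (UnitaryGroup.LocalRing L v)).val.charpoly).map (Pi.evalRingHom (fun w' : PlacesOver L v => w'.1.adicCompletion L) w)).roots,
          ‖r - a‖ < η := by
  haveI : ProperSpace (w.1.adicCompletion L) := properSpace_adicCompletion L w.1
  set f : Gqs L v → (w.1.adicCompletion L)[X] := fun y =>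
    ((y.val : GL (Fin 3) (UnitaryGroup.LocalRing L v)).val.charpoly).map (Pi.evalRingHom (fun w' : PlacesOver L v => w'.1.adicCompletion L) w) with hf
  obtain ⟨ε, hε, hnear⟩ := F0P3cStCharTSRootCalculus.exists_forall_root_near (f x) (monic_map_charpoly L v w x) hη
  have hdeg : ∀ᶠ y in 𝓝 x, (f y).natDegree < 4 := Filter.Eventually.of_forall fun y => by
    show (((y.val : GL (Fin 3) (UnitaryGroup.LocalRing L v)).val.charpoly).map _).natDegree < 4
    rw [natDegree_map_charpoly]; norm_num
  have hcoeff : ∀ i, ContinuousAt (fun y => (f y).coeff i) x := fun i => by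
    have h := (F0P3cStCharTSEllOpen.continuous_evalPlace_charpoly_coeff L v w i).continuousAt (x := x)
    simpa only [hf, coeff_map] using h
  -- coefficients within `ε` (finitely many below degree `4`, the rest vanish) — the pattern of ★ MOVING-ROOT `eventually_forall_norm_coeff_sub_lt`
  have hfin : ∀ᶠ y in 𝓝 x, ∀ i ∈ Finset.range 4, ‖(f y).coeff i - (f x).coeff i‖ < ε := by
    rw [Filter.eventually_all_finset]
    intro i _
    have h := Metric.tendsto_nhds.1 (hcoeff i) ε hε
    refine h.mono fun y hy => ?_
    rwa [dist_eq_norm] at hy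
  have hcoe : ∀ᶠ y in 𝓝 x, ∀ i, ‖(f y).coeff i - (f x).coeff i‖ < ε := by
    filter_upwards [hfin, hdeg] with y hy hdy i
    by_cases hi : i < 4
    · exact hy i (Finset.mem_range.2 hi)
    · have hxi : (f x).natDegree < i := lt_of_lt_of_le hdeg.self_of_nhds (not_lt.1 hi)
      have hyi : (f y).natDegree < i := lt_of_lt_of_le hdy (not_lt.1 hi)
      rw [coeff_eq_zero_of_natDegree_lt hxi, coeff_eq_zero_of_natDegree_lt hyi, sub_zero, norm_zero]
      exact hε
  filter_upwards [hcoe] with y hy r hr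
  exact hnear (f y) (monic_map_charpoly L v w y) (by rw [natDegree_map_charpoly, natDegree_map_charpoly]) hy r hr

/-- **NO NEW NORM-ONE ROOTS.**  Let `x ∈ U(Φ₃)(L⁺_v)`, `A` a finset containing every norm-one root of `(charpoly x)_w` (`σ_w a·a = 1`), and for each `a ∈ A` a moved root `u_a` with
window `δ_a > 0` in which, for `y` near `x`, `u_a(y)` is the ONLY root of `(charpoly y)_w` (the window clause of ★ `exists_continuousAt_root`).  Then for `y` near `x` every
norm-one root `r` of `(charpoly y)_w` is `u_a(y)` for some `a ∈ A`: `r` is near an old root `b` (`eventually_forall_root_near`); if `b` is norm-one then `b ∈ A` and `r` is in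
its window; if not, `σ_w r·r ≠ 1` near `b` (an open condition) — contradiction. [cite: Rogawski1990, §5.4 p. 78; §12.5 pp. 182–184] -/
theorem eventually_forall_norm_one_root_eq (w : PlacesOver L v) (hw : IsCMField.complexConj L • w.1 = w.1) (x : Gqs L v)
    (A : Finset (w.1.adicCompletion L))
    (hA : ∀ a : w.1.adicCompletion L,
      (((x.val : GL (Fin 3) (UnitaryGroup.LocalRing L v)).val.charpoly).map (Pi.evalRingHom (fun w' : PlacesOver L v => w'.1.adicCompletion L) w)).IsRoot a →
        galAdicCompletionMap (L := L) (IsCMField.complexConj L) hw a * a = 1 → a ∈ A)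
    (u : w.1.adicCompletion L → Gqs L v → w.1.adicCompletion L) (δ : w.1.adicCompletion L → ℝ) (hδ : ∀ a ∈ A, 0 < δ a)
    (hwin : ∀ a ∈ A, ∀ᶠ y in 𝓝 x, ∀ r : w.1.adicCompletion L,
      (((y.val : GL (Fin 3) (UnitaryGroup.LocalRing L v)).val.charpoly).map (Pi.evalRingHom (fun w' : PlacesOver L v => w'.1.adicCompletion L) w)).IsRoot r →
        ‖r - a‖ < δ a → r = u a y) :
    ∀ᶠ y in 𝓝 x, ∀ r : w.1.adicCompletion L,
      (((y.val : GL (Fin 3) (UnitaryGroup.LocalRing L v)).val.charpoly).map (Pi.evalRingHom (fun w' : PlacesOver L v => w'.1.adicCompletion L) w)).IsRoot r →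
        galAdicCompletionMap (L := L) (IsCMField.complexConj L) hw r * r = 1 → ∃ a ∈ A, r = u a y := by
  classical
  set σw := galAdicCompletionMap (L := L) (IsCMField.complexConj L) hw with hσw
  set p₀ := ((x.val : GL (Fin 3) (UnitaryGroup.LocalRing L v)).val.charpoly).map (Pi.evalRingHom (fun w' : PlacesOver L v => w'.1.adicCompletion L) w) with hp₀
  have hp₀0 : p₀ ≠ 0 := (monic_map_charpoly L v w x).ne_zero
  -- the norm map `r ↦ σ_w r · r` is continuous; around a non-norm-one point it stays `≠ 1`
  have hg : Continuous fun r : w.1.adicCompletion L => σw r * r := (continuous_galAdicCompletionMap L (IsCMField.complexConj L) hw).mul continuous_id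
  have hexcl : ∀ b : w.1.adicCompletion L, ∃ ρ : ℝ, 0 < ρ ∧ (σw b * b ≠ 1 → ∀ r, ‖r - b‖ < ρ → σw r * r ≠ 1) := fun b => by
    by_cases hb : σw b * b = 1
    · exact ⟨1, one_pos, fun h => absurd hb h⟩
    · have hopen : IsOpen {r : w.1.adicCompletion L | σw r * r ≠ 1} := isOpen_ne.preimage hg
      obtain ⟨ρ, hρ, hball⟩ := Metric.isOpen_iff.1 hopen b hb
      refine ⟨ρ, hρ, fun _ r hr => hball ?_⟩
      rwa [Metric.mem_ball, dist_eq_norm]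
  choose ρ hρ hρexcl using hexcl
  -- one radius `η` below every window `δ_a` (`a ∈ A`) and every exclusion radius `ρ_b` (`b` an old root)
  set rad : w.1.adicCompletion L → ℝ := fun b => min (if b ∈ A then δ b else 1) (ρ b) with hrad
  have hradpos : ∀ b ∈ p₀.roots.toFinset, 0 < rad b := fun b _ => by
    refine lt_min ?_ (hρ b)
    split_ifs with h
    · exact hδ b h
    · exact one_pos
  obtain ⟨η, hη, hηle⟩ := F0P3cStCharTSRootCount.exists_pos_le_of_finset p₀.roots.toFinset rad hradpos
  -- the window clauses for all `a ∈ A` at once, and the root-nearness for `η`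
  have hwinA : ∀ᶠ y in 𝓝 x, ∀ a ∈ A, ∀ r : w.1.adicCompletion L,
      (((y.val : GL (Fin 3) (UnitaryGroup.LocalRing L v)).val.charpoly).map (Pi.evalRingHom (fun w' : PlacesOver L v => w'.1.adicCompletion L) w)).IsRoot r →
        ‖r - a‖ < δ a → r = u a y := (Filter.eventually_all_finset A).2 hwin
  filter_upwards [hwinA, eventually_forall_root_near L v w x hη] with y hyA hynear r hr hr1
  obtain ⟨b, hb, hrb⟩ := hynear r hr
  have hbF : b ∈ p₀.roots.toFinset := Multiset.mem_toFinset.2 hb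
  have hrb' : ‖r - b‖ < rad b := lt_of_lt_of_le hrb (hηle b hbF)
  by_cases hb1 : σw b * b = 1
  · -- `b` is an old norm-one root: `b ∈ A`, and `r` is in its window
    have hbA : b ∈ A := hA b ((mem_roots hp₀0).1 hb) hb1
    have hrδ : ‖r - b‖ < δ b := by
      have h := lt_of_lt_of_le hrb' (min_le_left _ _)
      rwa [if_pos hbA] at h
    exact ⟨b, hbA, hyA b hbA r hr hrδ⟩
  · -- `b` is not norm-one: no norm-one point within `ρ_b`
    exact absurd hr1 (hρexcl b hb1 r (lt_of_lt_of_le hrb' (min_le_right _ _)))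

end Summit.HodgeConjecture.HodgeConjecture.Cruxes.H413.F0P3cStCharTSNormOneRootsNear

end
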